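import Mathlib
import Summits.QuantumFields.QCD.Theorems.QuarksAsStableActionUnquenchedChessboardBoundStubMarginalRPDet
import HarnessLib

/-!
# Positivity of the Gram kernel of the Wilson fermion determinant (stub `stub_marginalRP` of crux
stmt-QuantumFields-9735, line Sketch — helper file 6)

The only inequality of the site-reflection positivity of `r = 1` Wilson quarks: for bare masses
`m ≥ -1` (hopping parameter `κ ≤ 1/6`) the chirality-diagonal spatial plane operator is positive
semidefinite, hence so is the Gram kernel `gramKernel U m = Γ(C)ᵀ ⊗ Γ(C)` of helper file 5.

* `hopT V k` — the spin-diagonal unitary hop `(x, a, α) ← (x + ê_k, b, α)` with the link matrix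
  `V(x,k)`; `hopT_conjTranspose_mul_self : (hopT V k)ᴴ hopT V k = 1`;
* `sdOp V m = (m + 1)·1 + ½ Σ_{k ≠ 0} (1 - hopT V k)ᴴ (1 - hopT V k)` is positive semidefinite for
  `m ≥ -1` (`posSemidef_sdOp`) and equals the spin-diagonal spatial Wilson operator
  `[α = β] planeOp` entrywise (`sdOp_apply`);
* the plane block of helper file 5 is a masked principal submatrix of `sdOp (apLift U) m`
  (`planeBlock_eq`), hence positive semidefinite (`posSemidef_planeBlock`); `Γ` of a positive
  semidefinite matrix is positive semidefinite (`posSemidef_Gamma`, via `A = Bᴴ B` from the spectral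
  theorem), and **`posSemidef_gramKernel`**.
-/

noncomputable section

open Matrix Complex Finset
open Literature.MathematicalPhysics.QuantumLattice Literature.MathematicalPhysics.QuantumFieldTheory
open Literature.Probability.LatticeModels
open scoped ComplexConjugate BigOperators Kronecker ComplexOrder

namespace Summit.QuantumFields.QCD.Theorems.UnquenchedChessboardBoundLine

section Hop

variable {L N : ℕ} [NeZero L] [Fact (1 < L)]

/-- The spin-diagonal unitary hop in the spatial direction `k`:
`(hopT V k)_{(x,a,α),(y,b,β)} = [y = x + ê_k] [α = β] V(x,k)_{ab}`. -/
def hopT (V : GaugeConfig 4 L (Matrix.unitaryGroup (Fin N) ℂ)) (k : Fin 4) :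
    Matrix (TorusSite 4 L × Fin N × Fin 4) (TorusSite 4 L × Fin N × Fin 4) ℂ :=
  Matrix.of fun p q => if q.1 = Site.shift p.1 k ∧ p.2.2 = q.2.2 then
    (V (p.1, k) : Matrix (Fin N) (Fin N) ℂ) p.2.1 q.2.1 else 0

omit [Fact (1 < L)] in
/-- **The hop is an isometry**: `(hopT V k)ᴴ hopT V k = 1` (link variables are unitary). -/
theorem hopT_conjTranspose_mul_self (V : GaugeConfig 4 L (Matrix.unitaryGroup (Fin N) ℂ)) (k : Fin 4) :
    (hopT V k)ᴴ * hopT V k = 1 := by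
  ext q q'
  rw [Matrix.mul_apply, Fintype.sum_prod_type, Finset.sum_eq_single (q.1 - Pi.single k 1)]
  · have hx : Site.shift (q.1 - Pi.single k 1) k = q.1 := sub_add_cancel _ _
    rw [Fintype.sum_prod_type, Finset.sum_comm, Finset.sum_eq_single q.2.2]
    · simp only [conjTranspose_apply, hopT, Matrix.of_apply, hx, and_true, if_true]
      by_cases hq : q'.1 = q.1 ∧ q.2.2 = q'.2.2
      · simp only [hq, and_self, if_true]
        have hu := congrFun (congrFun (Matrix.UnitaryGroup.star_mul_self (V (q.1 - Pi.single k 1, k))) q.2.1) q'.2.1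
        rw [Matrix.mul_apply] at hu
        simp only [Matrix.star_apply] at hu
        rw [hu, Matrix.one_apply, Matrix.one_apply]
        by_cases hqq : q = q'
        · subst hqq; simp
        · rw [if_neg hqq, if_neg]
          intro h
          exact hqq (Prod.ext hq.1.symm (Prod.ext h hq.2))
      · rw [Matrix.one_apply, if_neg (fun h => hq (by subst h; exact ⟨rfl, rfl⟩))]
        refine Finset.sum_eq_zero fun a _ => ?_
        rw [if_neg (fun h => hq ⟨h.1, h.2⟩), mul_zero]
    · intro β _ hβ
      refine Finset.sum_eq_zero fun a _ => ?_
      simp only [conjTranspose_apply, hopT, Matrix.of_apply]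
      rw [if_neg (fun h => hβ h.2), star_zero, zero_mul]
    · simp
  · intro x _ hx
    refine Finset.sum_eq_zero fun c _ => ?_
    simp only [conjTranspose_apply, hopT, Matrix.of_apply]
    rw [if_neg, star_zero, zero_mul]
    rintro ⟨h, -⟩
    exact hx (by rw [h]; exact (add_sub_cancel_right _ _).symm)
  · simp

/-- The manifestly positive form of the spin-diagonal spatial Wilson operator:
`(m + 1)·1 + ½ Σ_{k ≠ 0} (1 - T_k)ᴴ (1 - T_k)`. -/
def sdOp (V : GaugeConfig 4 L (Matrix.unitaryGroup (Fin N) ℂ)) (m : ℝ) :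
    Matrix (TorusSite 4 L × Fin N × Fin 4) (TorusSite 4 L × Fin N × Fin 4) ℂ :=
  ((m + 1 : ℝ) : ℂ) • 1 + (1 / 2 : ℂ) • ∑ k ∈ Finset.univ.erase (0 : Fin 4), (1 - hopT V k)ᴴ * (1 - hopT V k)

omit [Fact (1 < L)] in
/-- **Positivity for `m ≥ -1`.** -/
theorem posSemidef_sdOp (V : GaugeConfig 4 L (Matrix.unitaryGroup (Fin N) ℂ)) {m : ℝ} (hm : -1 ≤ m) :
    (sdOp V m).PosSemidef := by
  refine Matrix.PosSemidef.add (Matrix.PosSemidef.one.smul ?_) ((Matrix.posSemidef_sum _ fun k _ =>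
    Matrix.posSemidef_conjTranspose_mul_self _).smul ?_)
  · exact Complex.zero_le_real.2 (by linarith)
  · rw [show (1 / 2 : ℂ) = ((1 / 2 : ℝ) : ℂ) by push_cast; ring]
    exact Complex.zero_le_real.2 (by norm_num)

omit [Fact (1 < L)] in
/-- The expanded form `sdOp = (m + 4)·1 - ½ Σ_{k ≠ 0} (T_k + T_kᴴ)`. -/
theorem sdOp_eq (V : GaugeConfig 4 L (Matrix.unitaryGroup (Fin N) ℂ)) (m : ℝ) :
    sdOp V m = ((m + 4 : ℝ) : ℂ) • 1 - (1 / 2 : ℂ) • ∑ k ∈ Finset.univ.erase (0 : Fin 4), (hopT V k + (hopT V k)ᴴ) := by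
  have hk : ∀ k, (1 - hopT V k)ᴴ * (1 - hopT V k) = (2 : ℂ) • 1 - (hopT V k + (hopT V k)ᴴ) := by
    intro k
    rw [conjTranspose_sub, conjTranspose_one, Matrix.sub_mul, Matrix.mul_sub, Matrix.mul_sub, Matrix.one_mul,
      Matrix.one_mul, Matrix.mul_one, hopT_conjTranspose_mul_self, two_smul]
    abel
  simp only [sdOp, hk, Finset.sum_sub_distrib, Finset.sum_const, Finset.card_erase_of_mem (Finset.mem_univ _),
    Finset.card_univ, Fintype.card_fin, smul_sub]
  rw [← Nat.cast_smul_eq_nsmul ℂ, smul_smul, smul_smul, ← add_sub_assoc, ← add_smul]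
  congr 2
  push_cast
  ring

omit [Fact (1 < L)] in
/-- **Entries**: `sdOp` is the spin-diagonal spatial Wilson operator `[α = β] planeOp`. -/
theorem sdOp_apply (V : GaugeConfig 4 L (Matrix.unitaryGroup (Fin N) ℂ)) (m : ℝ)
    (p q : TorusSite 4 L × Fin N × Fin 4) :
    sdOp V m p q = if p.2.2 = q.2.2 then planeOp (unitaryFundamentalRep (Fin N) ℂ) V m p.1 p.2.1 q.1 q.2.1 else 0 := by
  rw [sdOp_eq]
  simp only [Matrix.sub_apply, Matrix.smul_apply, Matrix.one_apply, Matrix.sum_apply, Matrix.add_apply,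
    conjTranspose_apply, hopT, Matrix.of_apply, smul_eq_mul, planeOp, unitaryFundamentalRep_apply]
  by_cases hs : p.2.2 = q.2.2
  · rw [if_pos hs]
    congr 1
    · by_cases hpq : p = q
      · subst hpq; simp
      · rw [if_neg hpq, if_neg (fun h => hpq (Prod.ext h.1 (Prod.ext h.2 hs))), mul_zero]
    · rw [Finset.mul_sum, Finset.mul_sum]
      rw [← Finset.sum_erase_add _ _ (Finset.mem_univ (0 : Fin 4)), if_pos rfl, mul_zero, add_zero]
      refine Finset.sum_congr rfl fun k hk => ?_
      rw [if_neg (Finset.ne_of_mem_erase hk)]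
      congr 2
      · simp only [hs, and_true]
      · simp only [hs, and_true, Matrix.UnitaryGroup.inv_apply, Matrix.star_apply]
        split_ifs with h
        · rfl
        · rw [star_zero]
  · rw [if_neg hs, if_neg (fun h => hs (by rw [h])), mul_zero, zero_sub, neg_eq_zero]
    refine mul_eq_zero.2 (Or.inr (Finset.sum_eq_zero fun k _ => ?_))
    rw [if_neg (fun h => hs h.2), if_neg (fun h => hs h.2.symm), star_zero, add_zero]

omit [NeZero L] [Fact (1 < L)] in
/-- The spatial plane operator vanishes between different time slices. -/
theorem planeOp_eq_zero_of_tv_ne {G : Type*} [Group G] (ρ : G →* Matrix (Fin N) (Fin N) ℂ) (V : GaugeConfig 4 L G)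
    (m : ℝ) {x y : TorusSite 4 L} (h : tv x ≠ tv y) (a b : Fin N) : planeOp ρ V m x a y b = 0 := by
  unfold planeOp
  rw [if_neg (fun h' => h (by rw [h'.1])), zero_sub, neg_eq_zero]
  refine mul_eq_zero.2 (Or.inr (Finset.sum_eq_zero fun k _ => ?_))
  split_ifs with hk h1 h2 h2
  · rfl
  · exact absurd (congrArg tv h1) (by rw [tv_shift_ne _ hk]; exact Ne.symm h)
  · exact absurd (congrArg tv h1) (by rw [tv_shift_ne _ hk]; exact Ne.symm h)
  · exact absurd (congrArg tv h2) (by rw [tv_shift_ne _ hk]; exact h)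
  · simp

/-- **Plane entries of the chiral Wilson–Dirac matrix are entries of `sdOp`** (upper plane indices). -/
theorem wdc_plane_eq_sdOp (hL : Even L) (h4 : 4 ≤ L) (V : GaugeConfig 4 L (Matrix.unitaryGroup (Fin N) ℂ)) (m : ℝ)
    {p q : TorusSite 4 L × Fin N × Fin 4} (hp : p ∈ upIdx) (hq : q ∈ upIdx) (hpl : p ∈ planeIdx)
    (hql : q ∈ planeIdx) :
    wilsonDiracG (unitaryFundamentalRep (Fin N) ℂ) chiralGamma V m 1 p q = sdOp V m p q := by
  have hL' := Nat.even_iff.1 hL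
  rw [sdOp_apply]
  rw [mem_upIdx] at hp hq
  rw [mem_planeIdx] at hpl hql
  by_cases ht : tv p.1 = tv q.1
  · exact wdc_sameSlice _ V m ht (by omega)
  · rw [wdc_eq_zero_of_tv _ V m ht, planeOp_eq_zero_of_tv_ne _ V m ht, ite_self]
    · intro h; exfalso; split_ifs at h <;> omega
    · intro h; exfalso; split_ifs at h <;> omega

end Hop

/-! ## Positivity of the plane block, of its minors, and of the Gram kernel -/

section Kernel

variable {L N : ℕ} [NeZero L] [Fact (1 < L)]

/-- The plane mask. -/
def planeMask (p : TorusSite 4 L × Fin N × Fin 4) : ℂ := if p ∈ planeIdx then 1 else 0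

/-- **The plane block is a masked principal submatrix of `sdOp (apLift U) m`.** -/
theorem planeBlock_eq (hL : Even L) (h4 : 4 ≤ L) (U : GaugeConfig 4 L (Matrix.specialUnitaryGroup (Fin N) ℂ)) (m : ℝ) :
    planeBlock U m = ((diagonal planeMask)ᴴ * sdOp (apLift U) m * diagonal planeMask).submatrix (upEnum L N) (upEnum L N) := by
  have hh : (diagonal (planeMask (L := L) (N := N)))ᴴ = diagonal planeMask := by
    rw [diagonal_conjTranspose]
    congr 1
    funext p
    simp only [Pi.star_apply, planeMask, apply_ite star, star_one, star_zero]
  rw [hh]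
  ext i j
  simp only [planeBlock, Matrix.of_apply, Matrix.submatrix_apply, mul_diagonal, diagonal_mul, planeMask]
  by_cases hi : upEnum L N i ∈ planeIdx
  · by_cases hj : upEnum L N j ∈ planeIdx
    · rw [if_pos ⟨hi, hj⟩, if_pos hi, if_pos hj, one_mul, mul_one,
        wdc_plane_eq_sdOp hL h4 _ m (upEnum_mem i) (upEnum_mem j) hi hj]
    · rw [if_neg (fun h => hj h.2), if_neg hj, mul_zero]
  · rw [if_neg (fun h => hi h.1), if_neg hi, zero_mul, zero_mul]

/-- **The plane block is positive semidefinite for `m ≥ -1`.** -/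
theorem posSemidef_planeBlock (hL : Even L) (h4 : 4 ≤ L) (U : GaugeConfig 4 L (Matrix.specialUnitaryGroup (Fin N) ℂ))
    {m : ℝ} (hm : -1 ≤ m) : (planeBlock U m).PosSemidef := by
  rw [planeBlock_eq hL h4]
  exact ((posSemidef_sdOp (apLift U) hm).conjTranspose_mul_mul_same _).submatrix _

/-- A positive semidefinite complex matrix is a Gram matrix `Bᴴ B` (spectral theorem). -/
theorem exists_eq_conjTranspose_mul_self {n : Type*} [Fintype n] [DecidableEq n] {A : Matrix n n ℂ}
    (hA : A.PosSemidef) : ∃ B : Matrix n n ℂ, A = Bᴴ * B := by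
  set W : Matrix n n ℂ := (hA.1.eigenvectorUnitary : Matrix n n ℂ) with hW
  set s : n → ℂ := fun i => ((Real.sqrt (hA.1.eigenvalues i) : ℝ) : ℂ) with hs
  refine ⟨diagonal s * star W, ?_⟩
  have hss : diagonal s * diagonal s = diagonal (RCLike.ofReal ∘ hA.1.eigenvalues) := by
    rw [diagonal_mul_diagonal]
    congr 1
    funext i
    simp only [hs, Function.comp_apply, ← Complex.ofReal_mul, Real.mul_self_sqrt (hA.eigenvalues_nonneg i)]
    rfl
  have hsd : (diagonal s)ᴴ = diagonal s := by
    rw [diagonal_conjTranspose]; congr 1; funext i; simp [hs]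
  rw [conjTranspose_mul, hsd, Matrix.mul_assoc, ← Matrix.mul_assoc (diagonal s), hss]
  conv_lhs => rw [hA.1.spectral_theorem, Unitary.conjStarAlgAut_apply]
  rw [← hW, Matrix.mul_assoc]
  congr 1
  rw [star_eq_conjTranspose, conjTranspose_conjTranspose]

/-- **`Γ` of a positive semidefinite matrix is positive semidefinite** (`Γ(BᴴB) = Γ(B)ᴴ Γ(B)`). -/
theorem posSemidef_Gamma {ι : Type*} [LinearOrder ι] [Fintype ι] {C : Matrix ι ι ℂ} (hC : C.PosSemidef) :
    (Gamma C).PosSemidef := by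
  obtain ⟨B, rfl⟩ := exists_eq_conjTranspose_mul_self hC
  rw [Gamma_mul, Gamma_conjTranspose]
  exact Matrix.posSemidef_conjTranspose_mul_self _

end Kernel

/-- **The Gram kernel of the Wilson fermion determinant is positive semidefinite for `m ≥ -1`.** -/
theorem posSemidef_gramKernel {L N : ℕ} [NeZero L] [Fact (1 < L)] (hL : Even L) (h4 : 4 ≤ L)
    (U : GaugeConfig 4 L (Matrix.specialUnitaryGroup (Fin N) ℂ)) {m : ℝ} (hm : -1 ≤ m) :
    (gramKernel U m).PosSemidef :=
  (posSemidef_Gamma (posSemidef_planeBlock hL h4 U hm)).transpose.kronecker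
    (posSemidef_Gamma (posSemidef_planeBlock hL h4 U hm))

end Summit.QuantumFields.QCD.Theorems.UnquenchedChessboardBoundLine

end
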